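import Mathlib
import Summits.Ventures.PercRepro2.TB14Hall

/-!
# Row 2′TB: the NoDep slice (I) — `o`'s component of the arms is an admissible flip set
(blind cell PercRepro2, mine-c g23, 2026-08-26; `conjectures/MINE-C.md` §32.4; generalises
`TB14TrivialCore.lean` from the core `{a₂}` to every core)

All-free profile; `T_r`, `T_b` the red and blue clusters of `a₂`, `K := T_r ∩ T_b` the CORE.  The
ARMS are the vertices in exactly one of the two clusters (`Arms`); `C_o` is the component of `o`
in the graph induced on the arms by all edges (`oArm`; a source has `o` in the red arm).  Here:
* `red_of_mem_oArm`: `C_o ⊆ T_r ∖ T_b` (the two arms are not adjacent);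
* `route_of_mem_oArm`: from every vertex of `C_o` a red route through `C_o` reaches a vertex of
  the blue cluster (a core vertex, or `a₂`);
* `admissible_oArm`, `isTgt_starFlip_oArm`: `C_o` is an admissible flip set of EVERY source
  (p5's (Z1)–(Z3)), so its star flip is a target — the canonical move with `Z = C_o`.
`NoDep` (no core vertex is red-joined to `a₂` only through `C_o`) is the hypothesis of part II
(`TB14NoDepInv.lean`), where the flip is an involution of the slice.  Own work; standard axioms.
-/

namespace Summit.Ventures.PercRepro2

namespace TB14NoDep

open CovForm A3InactiveTyped TB14FlipFamily TB14Hall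

section Defs

variable {V : Type} {E : Type} [DecidableEq E] [Fintype V]
variable (ends : E → Sym2 V) (a₂ o : V) (F : Finset E)

/-- The ARMS of `a₂`: the vertices in exactly one of its two clusters. -/
def Arms (y : Config E) (v : V) : Prop :=
  (Conn ends y a₂ v ∧ ¬ Conn ends (flipOn F y) a₂ v) ∨
    (¬ Conn ends y a₂ v ∧ Conn ends (flipOn F y) a₂ v)

open scoped Classical in
/-- The configuration with exactly the edges inside the arms open (every colour). -/
noncomputable def armsCfg (y : Config E) : Config E :=
  fun e => decide (∀ x ∈ ends e, Arms ends a₂ F y x)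

open scoped Classical in
/-- `C_o`: the component of `o` in the graph induced on the arms. -/
noncomputable def oArm (y : Config E) : Finset V :=
  Finset.univ.filter fun v => Conn ends (armsCfg ends a₂ F y) o v

/-- **No dependent core vertex**: every vertex of the core stays red-connected to `a₂` when the
edges at `C_o` are closed. -/
def NoDep (y : Config E) : Prop :=
  ∀ v, Conn ends y a₂ v → Conn ends (flipOn F y) a₂ v →
    Conn ends (offZ ends (oArm ends a₂ o F y) y) a₂ v

end Defs

section Lemmas

variable {V : Type} {E : Type} [DecidableEq E] [Fintype V]
variable (ends : E → Sym2 V) (a₁ a₂ b o : V) (F : Finset E)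

/-- An open edge of `armsCfg` has both ends in the arms. -/
lemma arms_of_armsCfg {y : Config E} {e : E} (he : armsCfg ends a₂ F y e = true) {x : V}
    (hx : x ∈ ends e) : Arms ends a₂ F y x := by
  classical
  unfold armsCfg at he
  exact (of_decide_eq_true he) x hx

/-- Membership in `C_o`. -/
lemma mem_oArm_iff (y : Config E) (v : V) :
    v ∈ oArm ends a₂ o F y ↔ Conn ends (armsCfg ends a₂ F y) o v := by
  classical
  unfold oArm
  rw [Finset.mem_filter]
  exact ⟨fun h => h.2, fun h => ⟨Finset.mem_univ _, h⟩⟩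

/-- An edge inside the arms is open in `armsCfg`. -/
lemma armsCfg_eq_true {y : Config E} {e : E} (h : ∀ x ∈ ends e, Arms ends a₂ F y x) :
    armsCfg ends a₂ F y e = true := by
  classical
  unfold armsCfg
  exact decide_eq_true h

/-- Every vertex of `C_o` is in the arms (for `o` in the arms). -/
lemma arms_of_mem_oArm {y : Config E} (ho : Arms ends a₂ F y o) {v : V}
    (hv : v ∈ oArm ends a₂ o F y) : Arms ends a₂ F y v := by
  have hv' : Conn ends (armsCfg ends a₂ F y) o v := (mem_oArm_iff ends a₂ o F y v).1 hv
  refine mem_of_conn_of_closed (ends := ends) (ω := armsCfg ends a₂ F y)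
    (S := {x : V | Arms ends a₂ F y x}) ?_ ho hv'
  intro x _ z hxz
  obtain ⟨_, e, he, hends⟩ := openGraph_adj.1 hxz
  exact arms_of_armsCfg ends a₂ F he (by rw [hends]; exact Sym2.mem_mk_right x z)

/-- `C_o` is closed under adjacency inside the arms. -/
lemma mem_oArm_of_adj {y : Config E} (ho : Arms ends a₂ F y o) {v u : V}
    (hv : v ∈ oArm ends a₂ o F y) (hu : Arms ends a₂ F y u) {e : E} (hends : ends e = s(v, u)) :
    u ∈ oArm ends a₂ o F y := by
  have hv' : Conn ends (armsCfg ends a₂ F y) o v := (mem_oArm_iff ends a₂ o F y v).1 hv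
  have hva : Arms ends a₂ F y v := arms_of_mem_oArm ends a₂ o F ho hv
  have he : armsCfg ends a₂ F y e = true := by
    refine armsCfg_eq_true ends a₂ F ?_
    intro x hx
    rw [hends, Sym2.mem_iff] at hx
    rcases hx with rfl | rfl
    · exact hva
    · exact hu
  exact (mem_oArm_iff ends a₂ o F y u).2 (conn_trans hv' (conn_of_openAdj ⟨e, he, hends⟩))

omit [Fintype V] in
/-- A vertex of both clusters is not in the arms. -/
lemma not_arms_of_both {y : Config E} {v : V} (hr : Conn ends y a₂ v)
    (hb : Conn ends (flipOn F y) a₂ v) : ¬ Arms ends a₂ F y v := by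
  rintro (⟨_, h⟩ | ⟨h, _⟩)
  · exact h hb
  · exact h hr

omit [Fintype V] in
/-- A red vertex of the arms is not blue. -/
lemma not_blue_of_arms_red {y : Config E} {v : V} (hv : Arms ends a₂ F y v)
    (hr : Conn ends y a₂ v) : ¬ Conn ends (flipOn F y) a₂ v := by
  rcases hv with ⟨_, h⟩ | ⟨h, _⟩
  · exact h
  · exact absurd hr h

/-- `a₂ ∉ C_o`. -/
lemma a2_not_mem_oArm {y : Config E} (ho : Arms ends a₂ F y o) : a₂ ∉ oArm ends a₂ o F y :=
  fun h => not_arms_of_both ends a₂ F (conn_refl _ _ _) (conn_refl _ _ _)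
    (arms_of_mem_oArm ends a₂ o F ho h)

/-- `o ∈ C_o`. -/
lemma o_mem_oArm (y : Config E) : o ∈ oArm ends a₂ o F y :=
  (mem_oArm_iff ends a₂ o F y o).2 (conn_refl _ _ _)

omit [Fintype V] in
/-- A source has `o` in the red arm. -/
lemma arms_o_of_isSrc {y : Config E} (hs : IsSrc ends a₁ a₂ b o F y) : Arms ends a₂ F y o :=
  Or.inl ⟨hs.ho, hs.ho'⟩

/-- In a source every vertex of `C_o` is in `T_r ∖ T_b` (the two arms are not adjacent). -/
lemma red_of_mem_oArm (hF : ∀ e, e ∈ F) {y : Config E} (hs : IsSrc ends a₁ a₂ b o F y)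
    {v : V} (hv : v ∈ oArm ends a₂ o F y) :
    Conn ends y a₂ v ∧ ¬ Conn ends (flipOn F y) a₂ v := by
  have hv' : Conn ends (armsCfg ends a₂ F y) o v := (mem_oArm_iff ends a₂ o F y v).1 hv
  refine mem_of_conn_of_closed (ends := ends) (ω := armsCfg ends a₂ F y)
    (S := {x : V | Conn ends y a₂ x ∧ ¬ Conn ends (flipOn F y) a₂ x}) ?_ ⟨hs.ho, hs.ho'⟩ hv'
  rintro x ⟨hxr, hxb⟩ z hxz
  obtain ⟨_, e, he, hends⟩ := openGraph_adj.1 hxz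
  have hza : Arms ends a₂ F y z :=
    arms_of_armsCfg ends a₂ F he (by rw [hends]; exact Sym2.mem_mk_right x z)
  simp only [Set.mem_setOf_eq]
  cases hye : y e with
  | true =>
    have hzr : Conn ends y a₂ z := conn_trans hxr (conn_of_openAdj ⟨e, hye, hends⟩)
    exact ⟨hzr, not_blue_of_arms_red ends a₂ F hza hzr⟩
  | false =>
    have hblue : flipOn F y e = true := by unfold flipOn; rw [if_pos (hF e), hye]; rfl
    have hzb : ¬ Conn ends (flipOn F y) a₂ z := fun hzb =>
      hxb (conn_trans hzb (conn_of_openAdj ⟨e, hblue, by rw [hends, Sym2.eq_swap]⟩))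
    refine ⟨?_, hzb⟩
    rcases hza with ⟨h, _⟩ | ⟨_, h⟩
    · exact h
    · exact absurd h hzb

/-- A red neighbour of `C_o` outside `C_o` is a core vertex (in the blue cluster). -/
lemma blue_of_red_adj_oArm (hF : ∀ e, e ∈ F) {y : Config E} (hs : IsSrc ends a₁ a₂ b o F y)
    {x z : V} (hx : x ∈ oArm ends a₂ o F y) (hz : z ∉ oArm ends a₂ o F y) {e : E}
    (he : y e = true) (hends : ends e = s(x, z)) :
    Conn ends y a₂ z ∧ Conn ends (flipOn F y) a₂ z := by
  have ho : Arms ends a₂ F y o := arms_o_of_isSrc ends a₁ a₂ b o F hs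
  have hxr : Conn ends y a₂ x := (red_of_mem_oArm ends a₁ a₂ b o F hF hs hx).1
  have hzr : Conn ends y a₂ z := conn_trans hxr (conn_of_openAdj ⟨e, he, hends⟩)
  refine ⟨hzr, ?_⟩
  by_contra hzb
  exact hz (mem_oArm_of_adj ends a₂ o F ho hx (Or.inl ⟨hzr, hzb⟩) hends)

/-- **The red route**: from any vertex of `C_o` a red route through `C_o` reaches a vertex of the
blue cluster of `a₂`. -/
lemma route_of_mem_oArm (hF : ∀ e, e ∈ F) {y : Config E} (hs : IsSrc ends a₁ a₂ b o F y)
    {v : V} (hv : v ∈ oArm ends a₂ o F y) :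
    ∃ c, Conn ends (flipOn F y) a₂ c ∧ Conn ends (routeCfg ends (oArm ends a₂ o F y) c y) v c := by
  set Z := oArm ends a₂ o F y with hZ
  have ho : Arms ends a₂ F y o := arms_o_of_isSrc ends a₁ a₂ b o F hs
  have hvr : Conn ends y v a₂ := conn_symm (red_of_mem_oArm ends a₁ a₂ b o F hF hs hv).1
  have key : a₂ ∈ {x : V | (x ∈ Z ∧ ∀ c, Conn ends (routeCfg ends Z c y) v x) ∨
      ∃ c, Conn ends (flipOn F y) a₂ c ∧ Conn ends (routeCfg ends Z c y) v c} := by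
    refine mem_of_conn_of_closed (ends := ends) (ω := y) ?_
      (Or.inl ⟨hv, fun c => conn_refl _ _ _⟩) hvr
    rintro x hx z hxz
    obtain ⟨_, e, he, hends⟩ := openGraph_adj.1 hxz
    simp only [Set.mem_setOf_eq] at hx ⊢
    rcases hx with ⟨hxZ, hxc⟩ | hdone
    · have hT : Touch ends Z e := touch_of_ends ends hends hxZ
      by_cases hzZ : z ∈ Z
      · refine Or.inl ⟨hzZ, fun c => ?_⟩
        have hall : ∀ w ∈ ends e, w ∈ Z ∨ w = c := by
          intro w hw
          rw [hends, Sym2.mem_iff] at hw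
          rcases hw with rfl | rfl
          · exact Or.inl hxZ
          · exact Or.inl hzZ
        have hroute : routeCfg ends Z c y e = true := by
          unfold routeCfg
          rw [if_pos ⟨hT, hall⟩]
          exact he
        exact conn_trans (hxc c) (conn_of_openAdj ⟨e, hroute, hends⟩)
      · obtain ⟨_, hzb⟩ := blue_of_red_adj_oArm ends a₁ a₂ b o F hF hs hxZ hzZ he hends
        have hall : ∀ w ∈ ends e, w ∈ Z ∨ w = z := by
          intro w hw
          rw [hends, Sym2.mem_iff] at hw
          rcases hw with rfl | rfl
          · exact Or.inl hxZ
          · exact Or.inr rfl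
        have hroute : routeCfg ends Z z y e = true := by
          unfold routeCfg
          rw [if_pos ⟨hT, hall⟩]
          exact he
        exact Or.inr ⟨z, hzb, conn_trans (hxc z) (conn_of_openAdj ⟨e, hroute, hends⟩)⟩
    · exact Or.inr hdone
  simp only [Set.mem_setOf_eq] at key
  rcases key with ⟨h, _⟩ | h
  · exact absurd h (a2_not_mem_oArm ends a₂ o F ho)
  · exact h

/-- **`C_o` is an admissible flip set** of every source. -/
theorem admissible_oArm (hF : ∀ e, e ∈ F) {y : Config E} (hs : IsSrc ends a₁ a₂ b o F y) :
    Admissible ends a₁ a₂ o F (oArm ends a₂ o F y) y := by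
  have ho : Arms ends a₂ F y o := arms_o_of_isSrc ends a₁ a₂ b o F hs
  refine ⟨fun v hv => red_of_mem_oArm ends a₁ a₂ b o F hF hs hv, o_mem_oArm ends a₂ o F y,
    route_of_mem_oArm ends a₁ a₂ b o F hF hs (o_mem_oArm ends a₂ o F y), ?_, ?_⟩
  · -- (Z2)
    rintro v hv u ⟨e, -, hends⟩ hur hub
    exact mem_oArm_of_adj ends a₂ o F ho hv (Or.inl ⟨hur, hub⟩) hends
  · -- (Z3)
    rintro v hv u ⟨e, he, hends⟩ hu₁
    have hvr : Conn ends y a₂ v := (red_of_mem_oArm ends a₁ a₂ b o F hF hs hv).1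
    have hur : Conn ends y a₂ u := conn_trans hvr (conn_of_openAdj ⟨e, he, hends⟩)
    have hub : ¬ Conn ends (flipOn F y) a₂ u := fun hub => hs.q₂ (conn_trans hu₁ (conn_symm hub))
    exact mem_oArm_of_adj ends a₂ o F ho hv (Or.inl ⟨hur, hub⟩) hends

/-- **The star flip of `o`'s component of the arms is a target** (every source, every core). -/
theorem isTgt_starFlip_oArm (hF : ∀ e, e ∈ F) {y : Config E} (hs : IsSrc ends a₁ a₂ b o F y) :
    IsTgt ends a₁ a₂ b o F (starFlip ends (oArm ends a₂ o F y) y) :=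
  isTgt_starFlip ends a₁ a₂ b o F hF hs (admissible_oArm ends a₁ a₂ b o F hF hs)

end Lemmas

end TB14NoDep

end Summit.Ventures.PercRepro2
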